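import Summits.FinalStateConjecture.FinalStateConjecture.Theorems.EIHFluxBalanceInertialRecessionHolePackage

/-!
# Route EIHFluxBalance — `InertialRecession`: the `a = 0` hole-chart package, extended exports
# (coverage of the painted near zone, two-sided painted radius, lab-time function)

Helper file for the crux `stmt-FinalStateConjecture-10166`
(`Summit.FinalStateConjecture.FinalStateConjecture.Theses.EIHFluxBalance.InertialRecession`),
stub `stub_rechart` (the transfer P2 of line `sublinear-is-free-clean-window-charges`).

`hole_chart_package'` (file `…HolePackage`) hides the Fermi-type re-charting map `A` behind an
existential and exports its analytic properties. The CAUSAL part of the re-charting (files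
`…RechartHover`, `…RechartTransfer`, `…RechartKO`) needs three more facts about the same `A`, all
already proved for the construction: COVERAGE of the painted near zone (`fermiMap_honest_surjective`:
every late lab point whose painted rest offset `P_v(x̲ − ξᵢ)` has norm `≤ ρ/2` is `A x′` with explicit
model time `x⁰/γ − ⟪V, y̲⟫` and model radius `‖y̲‖`), the TWO-SIDED PAINTED RADIUS of `A x′` with
respect to any orthochronous frame of velocity `vᵢ` (`spatialNorm_symm_fermiMap_sub'`:
between `min(‖y̲‖, ρ/2)` and `‖y̲‖`), and the LAB-TIME FUNCTION of `A` (`A x′ ⁰ = θ(x′⁰)` with `θ`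
smooth, `θ′ > 0`, `θ = id` after `T + 1`; hence `(DA·w)⁰ = θ′·w⁰`). This file re-runs the assembly
of `hole_chart_package'` with these exports added (`hole_chart_package2'`, registered form
`hole_chart_package2`). [folklore]
-/

noncomputable section

set_option linter.dupNamespace false

open scoped Topology ContDiff InnerProductSpace BigOperators Manifold ENNReal
open Filter Set Metric Function TopologicalSpace Literature.Geometry.Lorentzian

namespace Summit.FinalStateConjecture.FinalStateConjecture.Theorems

/-! ### The time component of the differential of a map with a lab-time function -/

/-- If `A x ⁰ = θ(x⁰)` for a differentiable `θ` and `A` is differentiable at `x`, then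
`(DA(x) w)⁰ = θ′(x⁰) w⁰`. [folklore] -/
theorem fderiv_apply_zero_of_timeFunction {A : E4 → E4} {θ : ℝ → ℝ} (hAθ : ∀ x, A x 0 = θ (x 0))
    (hθ : Differentiable ℝ θ) {x : E4} (hA : DifferentiableAt ℝ A x) (w : E4) :
    (fderiv ℝ A x w) 0 = deriv θ (x 0) * w 0 := by
  set π : E4 →L[ℝ] ℝ := EuclideanSpace.proj 0 with hπ
  have hπA : HasFDerivAt (fun y ↦ π (A y)) (π.comp (fderiv ℝ A x)) x :=
    π.hasFDerivAt.comp x hA.hasFDerivAt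
  have hθπ : HasFDerivAt (fun y : E4 ↦ θ (π y))
      ((ContinuousLinearMap.smulRight (1 : ℝ →L[ℝ] ℝ) (deriv θ (π x))).comp π) x :=
    ((hθ (π x)).hasDerivAt.hasFDerivAt).comp x π.hasFDerivAt
  have heq : (fun y ↦ π (A y)) = fun y : E4 ↦ θ (π y) := by
    funext y
    show A y 0 = θ (y 0)
    exact hAθ y
  rw [heq] at hπA
  have h := hπA.unique hθπ
  have h2 := congrArg (fun L : E4 →L[ℝ] ℝ ↦ L w) h
  simp only [ContinuousLinearMap.comp_apply, ContinuousLinearMap.smulRight_apply,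
    smul_eq_mul] at h2
  show π (fderiv ℝ A x w) = deriv θ (π x) * π w
  rw [h2, mul_comm]
  rfl

/-- Registered one-line form (stub `fderiv_apply_zero_of_timeFunction_rechart` of the crux item) of
`fderiv_apply_zero_of_timeFunction`. [folklore] -/
theorem fderiv_apply_zero_of_timeFunction_rechart : open Literature.Geometry.Lorentzian in ∀ {A : E4 → E4} {θ : ℝ → ℝ}, (∀ x, A x 0 = θ (x 0)) → Differentiable ℝ θ → ∀ {x : E4}, DifferentiableAt ℝ A x → ∀ w : E4, (fderiv ℝ A x w) 0 = deriv θ (x 0) * w 0 :=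
  fun hAθ hθ _ hA w ↦ fderiv_apply_zero_of_timeFunction hAθ hθ hA w

/-! ### The extended package -/

section Package

variable (𝓢 : Spacetime 4) {N : ℕ} (i : Fin N) (M : Fin N → ℝ) (Λ : Fin N → ℝ → lorentzGroup)
  (ξ v : Fin N → ℝ → E3)
  (hfut : ∀ j t, 0 < (((Λ j t : E4 ≃L[ℝ] E4) (E4.basisVector 0)) 0))
  (hvΛ : ∀ j t, E4.spatial ((Λ j t : E4 ≃L[ℝ] E4) (E4.basisVector 0)) =
    (((Λ j t : E4 ≃L[ℝ] E4) (E4.basisVector 0)) 0) • v j t)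
  (U : Opens E4) (Φ : U → 𝓢.carrier) (hΦ : ContMDiff 𝓘(ℝ, E4) (𝓡 4) ∞ Φ)
  (hdev : Tendsto (fun t ↦ 𝓢.deviationCk ⟨U, fun x ↦ Minkowski.bilin +
    ∑ j, (boostedKerrBilin (Λ j (x 0)) (E4.ofTimeSpace (x 0) (ξ j (x 0))) (M j) 0 x -
      Minkowski.bilin), fun x ↦ x 0, E4.spatialNorm⟩ Φ 2 t) atTop (𝓝 0))
  {κ₀ : ℝ} (hκ₀ : κ₀ < 1) (hvs : ∀ j t, ‖v j t‖ ≤ κ₀)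
  (hv : ∀ j, ContDiff ℝ ∞ (v j)) (hξ : ∀ j, ContDiff ℝ ∞ (ξ j)) {Γ T₀ : ℝ}
  (hvb : ∀ j t, T₀ ≤ t → ∀ l, 1 ≤ l → l ≤ 2 → ‖iteratedDeriv l (v j) t‖ ≤ Γ)
  (hξb : ∀ j t, T₀ ≤ t → ∀ l, 1 ≤ l → l ≤ 2 → ‖iteratedDeriv l (ξ j) t‖ ≤ Γ)
  (hsep : ∀ j ≠ i, Tendsto (fun t ↦ ‖ξ i t - ξ j t‖) atTop atTop) (hMi : 0 < M i) {V : E3}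
  (hV : ‖V‖ < 1) (hvV : Tendsto (v i) atTop (𝓝 V)) (hξV : Tendsto (deriv (ξ i)) atTop (𝓝 V))
  (hξ0 : ∀ l, 2 ≤ l → l ≤ 3 → Tendsto (fun t ↦ iteratedDeriv l (ξ i) t) atTop (𝓝 0))
  (hv0 : ∀ l, 1 ≤ l → l ≤ 3 → Tendsto (fun t ↦ iteratedDeriv l (v i) t) atTop (𝓝 0))
  {τ₀ : ℝ} {rin : Fin N → ℝ} (hrin : ∀ j, rin j < Kerr.rPlus (M j) 0)
  (hU : {x : E4 | τ₀ < x 0 ∧ ∀ j, rin j < Kerr.radius 0 (poincareInv (Λ j (x 0))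
    (E4.ofTimeSpace (x 0) (ξ j (x 0))) x)} ⊆ (U : Set E4))

include hfut hvΛ hΦ hdev hκ₀ hvs hv hξ hvb hξb hsep hMi hvV hξV hξ0 hv0 hrin hU in
-- long chain of bookkeeping
set_option maxHeartbeats 800000 in
/-- **The `a = 0` hole-chart package, extended exports** (coverage, two-sided painted radius,
lab-time function; otherwise verbatim `hole_chart_package'`). Under the crux data for spins `0` (orthochronous painted
frames with lab velocities `‖vⱼ‖ ≤ κ₀ < 1`, lab-slab `C²` convergence, `U` containing the late
region outside the painted balls of radii `rinⱼ < r₊ⱼ`), eventual bounds on two derivatives of all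
`vⱼ, ξⱼ`, recession of the other holes from hole `i`, and the kinematic limits of hole `i`, there are
a late time `T ≥ τ₀`, a smooth excision profile `ρ → ∞`, `ρ > 0`, and a smooth open embedding
`A : E4 → E4` mapping the boosted Schwarzschild exterior of the final motion `(boost V, 0, Mᵢ)` into
`U` — every model point to a lab point of lab time `> T` within lab distance `2ρ` of the painted
centre, outside EVERY painted horizon when `‖y̲‖ > r₊ᵢ` (exactly, for the own one) — equal to the
honest placement on the honest zone `{x'⁰ ≥ T + 1, ‖y̲‖ ≤ ρ(x'⁰)/2}`, and such that the hole chart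
`ψ = Φ ∘ A` has `C²` deviation from boosted Schwarzschild on the truncated slabs `{t* = τ, r ≤ R}`
tending to `0` for every `R`. [folklore] -/
theorem hole_chart_package2' :
    ∃ (T : ℝ) (ρ : ℝ → ℝ) (A : E4 → E4)
      (hAU : ∀ y ∈ boostedKerrExterior (Lorentz.boost V hV) 0 (M i) 0, A y ∈ U),
      τ₀ ≤ T ∧ ContDiff ℝ ∞ A ∧ Topology.IsOpenEmbedding A ∧ ContDiff ℝ ∞ ρ ∧
      Tendsto ρ atTop atTop ∧ (∀ t, 0 < ρ t) ∧
      (∀ x : E4, T < A x 0 ∧ ‖E4.spatial (A x) - ξ i (A x 0)‖ < 2 * ρ (A x 0)) ∧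
      (∀ x : E4, Kerr.rPlus (M i) 0 < ‖E4.spatial ((Lorentz.boost V hV : E4 ≃L[ℝ] E4).symm x)‖ →
        ∀ j, Kerr.rPlus (M j) 0 <
          Kerr.radius 0 (poincareInv (Λ j (A x 0)) (E4.ofTimeSpace (A x 0) (ξ j (A x 0))) (A x))) ∧
      (∀ x : E4, T + 1 ≤ x 0 →
        ‖E4.spatial ((Lorentz.boost V hV : E4 ≃L[ℝ] E4).symm x)‖ ≤ ρ (x 0) / 2 →
        A x = E4.ofTimeSpace (x 0) (ξ i (x 0) +
          (E4.spatial ((Lorentz.boost V hV : E4 ≃L[ℝ] E4).symm x) -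
            (Lorentz.gamma (v i (x 0)) / (Lorentz.gamma (v i (x 0)) + 1) *
              inner ℝ (v i (x 0)) (E4.spatial ((Lorentz.boost V hV : E4 ≃L[ℝ] E4).symm x))) •
              v i (x 0)))) ∧
      -- coverage of the painted near zone
      (∀ x : E4, T + 1 ≤ x 0 →
        ‖E4.spatial x - ξ i (x 0) + (Lorentz.gamma (v i (x 0)) ^ 2 / (Lorentz.gamma (v i (x 0)) + 1) *
          inner ℝ (v i (x 0)) (E4.spatial x - ξ i (x 0))) • v i (x 0)‖ ≤ ρ (x 0) / 2 →
        ∃ x' : E4, A x' = x ∧ x' 0 = x 0 ∧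
          E4.spatial ((Lorentz.boost V hV : E4 ≃L[ℝ] E4).symm x') = E4.spatial x - ξ i (x 0) +
            (Lorentz.gamma (v i (x 0)) ^ 2 / (Lorentz.gamma (v i (x 0)) + 1) *
              inner ℝ (v i (x 0)) (E4.spatial x - ξ i (x 0))) • v i (x 0) ∧
          ((Lorentz.boost V hV : E4 ≃L[ℝ] E4).symm x') 0 =
            x 0 / Lorentz.gamma V - inner ℝ V (E4.spatial x - ξ i (x 0) +
              (Lorentz.gamma (v i (x 0)) ^ 2 / (Lorentz.gamma (v i (x 0)) + 1) *
                inner ℝ (v i (x 0)) (E4.spatial x - ξ i (x 0))) • v i (x 0))) ∧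
      -- two-sided painted radius with respect to any orthochronous frame of velocity `vᵢ`
      (∀ (x : E4) (Λ' : lorentzGroup), 0 < ((Λ' : E4 ≃L[ℝ] E4) (E4.basisVector 0)) 0 →
        E4.spatial ((Λ' : E4 ≃L[ℝ] E4) (E4.basisVector 0)) =
          (((Λ' : E4 ≃L[ℝ] E4) (E4.basisVector 0)) 0) • v i (A x 0) →
        min ‖E4.spatial ((Lorentz.boost V hV : E4 ≃L[ℝ] E4).symm x)‖ (ρ (A x 0) / 2) ≤
            E4.spatialNorm ((Λ' : E4 ≃L[ℝ] E4).symm (A x - E4.ofTimeSpace (A x 0) (ξ i (A x 0)))) ∧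
          E4.spatialNorm ((Λ' : E4 ≃L[ℝ] E4).symm (A x - E4.ofTimeSpace (A x 0) (ξ i (A x 0)))) ≤
            ‖E4.spatial ((Lorentz.boost V hV : E4 ≃L[ℝ] E4).symm x)‖) ∧
      -- the lab-time function
      (∃ θ : ℝ → ℝ, ContDiff ℝ ∞ θ ∧ StrictMono θ ∧ (∀ s, 0 < deriv θ s) ∧
        (∀ s, T + 1 ≤ s → θ s = s) ∧ (∀ x : E4, A x 0 = θ (x 0)) ∧
        ∀ x w : E4, (fderiv ℝ A x w) 0 = deriv θ (x 0) * w 0) ∧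
      ∀ (ψ : boostedKerrExterior (Lorentz.boost V hV) 0 (M i) 0 → 𝓢.carrier),
        (∀ y, ψ y = Φ ⟨A y.1, hAU y.1 y.2⟩) → ∀ R : ℝ,
          Tendsto (fun τ ↦ 𝓢.truncDeviationCk (boostedKerrBackground (Lorentz.boost V hV) 0 (M i) 0)
            ψ 2 R τ) atTop (𝓝 0) := by
  have hv1 : ∀ j t, ‖v j t‖ < 1 := fun j t ↦ (hvs j t).trans_lt hκ₀
  -- clamps and profile
  obtain ⟨σ, hσ, hσm, hσ1, hσid, hσle, hσ'⟩ := exists_strictTimeClamp'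
  obtain ⟨Gt, hGt, hGm, hGlt, hGid, hGgt, hGle, hGd⟩ := exists_coordClamp'
  set r : ℝ := 2 * ∑ j, Kerr.rPlus (M j) 0 with hr
  have hrj0 : ∀ j, 0 ≤ Kerr.rPlus (M j) 0 := by
    intro j
    have h1 : 0 ≤ √(M j ^ 2 - 0 ^ 2) := Real.sqrt_nonneg _
    have h2 : |M j| ≤ √(M j ^ 2 - 0 ^ 2) := by
      rw [show M j ^ 2 - 0 ^ 2 = M j ^ 2 by ring, Real.sqrt_sq_eq_abs]
    show 0 ≤ M j + √(M j ^ 2 - 0 ^ 2)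
    linarith [neg_abs_le (M j)]
  have hrj : ∀ j, Kerr.rPlus (M j) 0 ≤ ∑ j, Kerr.rPlus (M j) 0 := fun j ↦
    Finset.single_le_sum (f := fun j ↦ Kerr.rPlus (M j) 0) (fun j _ ↦ hrj0 j) (Finset.mem_univ j)
  have hsum0 : 0 ≤ ∑ j, Kerr.rPlus (M j) 0 := Finset.sum_nonneg fun j _ ↦ hrj0 j
  obtain ⟨ρ, hρc, hρr, hρt, T', hT'⟩ := exists_excisionProfile i ξ (fun j ↦ (hξ j).continuous) hsep r
  have hρ0 : ∀ t, 0 < ρ t := fun t ↦ by have := hρr t; rw [hr] at this; linarith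
  set T : ℝ := max T' τ₀ with hT
  -- the map
  set A : E4 → E4 := fun x ↦ E4.ofTimeSpace (T + 1 + σ (x 0 - T - 1))
      (ξ i (T + 1 + σ (x 0 - T - 1)) +
        ((ρ (T + 1 + σ (x 0 - T - 1)) • (WithLp.toLp 2 fun k ↦ Gt ((ρ (T + 1 + σ (x 0 - T - 1)))⁻¹ *
            E4.spatial ((Lorentz.boost V hV : E4 ≃L[ℝ] E4).symm x) k) : E3)) -
          (Lorentz.gamma (v i (T + 1 + σ (x 0 - T - 1))) /
              (Lorentz.gamma (v i (T + 1 + σ (x 0 - T - 1))) + 1) *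
            inner ℝ (v i (T + 1 + σ (x 0 - T - 1)))
              (ρ (T + 1 + σ (x 0 - T - 1)) • (WithLp.toLp 2 fun k ↦
                Gt ((ρ (T + 1 + σ (x 0 - T - 1)))⁻¹ *
                  E4.spatial ((Lorentz.boost V hV : E4 ≃L[ℝ] E4).symm x) k) : E3))) •
            v i (T + 1 + σ (x 0 - T - 1)))) with hAdef
  have hA : ∀ x : E4, A x = E4.ofTimeSpace (T + 1 + σ (x 0 - T - 1))
      (ξ i (T + 1 + σ (x 0 - T - 1)) +
        ((ρ (T + 1 + σ (x 0 - T - 1)) • (WithLp.toLp 2 fun k ↦ Gt ((ρ (T + 1 + σ (x 0 - T - 1)))⁻¹ *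
            E4.spatial ((Lorentz.boost V hV : E4 ≃L[ℝ] E4).symm x) k) : E3)) -
          (Lorentz.gamma (v i (T + 1 + σ (x 0 - T - 1))) /
              (Lorentz.gamma (v i (T + 1 + σ (x 0 - T - 1))) + 1) *
            inner ℝ (v i (T + 1 + σ (x 0 - T - 1)))
              (ρ (T + 1 + σ (x 0 - T - 1)) • (WithLp.toLp 2 fun k ↦
                Gt ((ρ (T + 1 + σ (x 0 - T - 1)))⁻¹ *
                  E4.spatial ((Lorentz.boost V hV : E4 ≃L[ℝ] E4).symm x) k) : E3))) •
            v i (T + 1 + σ (x 0 - T - 1)))) := fun x ↦ rfl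
  -- image control
  have hρr' : ∀ θ, 2 * Kerr.rPlus (M i) 0 + 2 ≤ ρ θ := fun θ ↦ by
    have h1 := hρr θ; have h2 := hrj i; rw [hr] at h1; linarith
  have hρsep' : ∀ θ, T < θ → ∀ j ≠ i, 2 * ρ θ + Kerr.rPlus (M j) 0 ≤ ‖ξ i θ - ξ j θ‖ := by
    intro θ hθ j hj
    have h1 := hT' θ ((le_max_left _ _).trans hθ.le) j hj
    have h2 := hrj j
    rw [hr] at h1
    linarith [hsum0]
  have himg := fun x (hx : Kerr.rPlus (M i) 0 < ‖E4.spatial ((Lorentz.boost V hV : E4 ≃L[ℝ] E4).symm x)‖) ↦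
    fermiMap_late_and_radii i M Λ ξ v hfut hvΛ hV hA hσ1 hGid hGgt hGle hGlt hρ0 (hv1 i) hρr' hρsep' x hx
  have hrp : 0 < Kerr.rPlus (M i) 0 := by
    have h1 : 0 ≤ √(M i ^ 2 - 0 ^ 2) := Real.sqrt_nonneg _
    show 0 < M i + √(M i ^ 2 - 0 ^ 2)
    linarith
  have hAU : ∀ y ∈ boostedKerrExterior (Lorentz.boost V hV) 0 (M i) 0, A y ∈ U := by
    intro y hy
    have hy' : Kerr.rPlus (M i) 0 < ‖E4.spatial ((Lorentz.boost V hV : E4 ≃L[ℝ] E4).symm y)‖ := by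
      have h := mem_boostedKerrExterior.mp hy
      rw [Kerr.mem_exterior, max_eq_left hrp.le, poincareInv_zero, Kerr.radius_zero_left] at h
      exact h
    obtain ⟨hT1, hrad⟩ := himg y hy'
    refine hU ⟨(le_max_right _ _).trans_lt hT1, fun j ↦ (hrin j).trans (hrad j)⟩
  -- the package
  have hAc : ContDiff ℝ ∞ A := contDiff_fermiMap hV hA hσ hGt hρc hρ0 (hξ i) (hv i) (hv1 i)
  refine ⟨T, ρ, A, hAU, le_max_right _ _, hAc, ?_, hρc, hρt, hρ0, ?_, fun x hx ↦ (himg x hx).2, ?_,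
    ?_, ?_, ?_, ?_⟩
  · exact isOpenEmbedding_fermiMap' hV hA hσ hσ' hGt hGm hGd hρc hρ0 (hξ i) (hv i) (hv1 i)
  · exact fun x ↦ ⟨lt_fermiMap_apply_zero hV hA hσ1 x, norm_spatial_fermiMap_sub_lt hV hA hGlt hρ0 (hv1 i) x⟩
  · exact fun x hx hy ↦ fermiMap_eq_of_honest hV hA hσid hGid hρ0 hx hy
  · -- coverage
    exact fun x hx hy ↦ fermiMap_honest_surjective i ξ v hV hA hσid hGid hρ0 (hv1 i) x hx hy
  · -- two-sided painted radius
    exact fun x Λ' h0 hvΛ' ↦ spatialNorm_symm_fermiMap_sub' hV hA hGid hGgt hGle hρ0 x Λ' h0 hvΛ'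
  · -- lab-time function
    have hθc : ContDiff ℝ ∞ (fun s ↦ T + 1 + σ (s - T - 1)) :=
      contDiff_const.add (hσ.comp ((contDiff_id.sub contDiff_const).sub contDiff_const))
    have hθd : ∀ s, deriv (fun s ↦ T + 1 + σ (s - T - 1)) s = deriv σ (s - T - 1) := by
      intro s
      rw [deriv_const_add]
      have e : (fun s ↦ σ (s - T - 1)) = fun s ↦ σ (s - (T + 1)) := by
        funext s; congr 1; ring
      rw [e, deriv_comp_sub_const]
      congr 1; ring
    refine ⟨fun s ↦ T + 1 + σ (s - T - 1), hθc, ?_, ?_, ?_, fun x ↦ fermiMap_apply_zero hV hA x, ?_⟩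
    · exact fun a b hab ↦ by simpa using hσm (by linarith : a - T - 1 < b - T - 1)
    · intro s
      rw [hθd]
      exact hσ' _
    · intro s hs
      show T + 1 + σ (s - T - 1) = s
      rw [hσid _ (by linarith)]
      ring
    · intro x w
      exact fderiv_apply_zero_of_timeFunction (θ := fun s ↦ T + 1 + σ (s - T - 1))
        (fun x ↦ fermiMap_apply_zero hV hA x) (hθc.differentiable (by simp))
        ((hAc.differentiable (by simp)) x) w
  · intro ψ hψ R
    exact tendsto_truncDeviationCk_holeChart' 𝓢 i M ξ v hv1 hV
      (Ah := fun x ↦ E4.ofTimeSpace (x 0) (ξ i (x 0) +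
        (ContinuousLinearMap.id ℝ E3 - (Lorentz.gamma (v i (x 0)) / (Lorentz.gamma (v i (x 0)) + 1)) •
          (innerSL ℝ (v i (x 0))).smulRight (v i (x 0)))
          (E4.spatial ((Lorentz.boost V hV : E4 ≃L[ℝ] E4).symm x))))
      (fun _ ↦ rfl)
      (H := fun j z ↦ boostedKerrBilin (Lorentz.boost (v j (z 0)) (hv1 j (z 0)))
        (E4.ofTimeSpace (z 0) (ξ j (z 0))) (M j) 0 z - Minkowski.bilin) (fun _ _ ↦ rfl)
      (Bb := fun z ↦ Minkowski.bilin + ∑ j, (boostedKerrBilin (Lorentz.boost (v j (z 0)) (hv1 j (z 0)))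
        (E4.ofTimeSpace (z 0) (ξ j (z 0))) (M j) 0 z - Minkowski.bilin)) (fun _ ↦ rfl)
      hξ hv U Φ hΦ hAc hAU hψ Λ hfut hvΛ hdev hκ₀ hvs hvb hξb hsep hMi hvV hξV hξ0 hv0 hρt
      hρc.continuous (T₁ := T) (fun x hx hy ↦ by
        rw [fermiMap_eq_of_honest hV hA hσid hGid hρ0 hx hy, restOffsetCLM_apply]) R


-- long statement
set_option maxHeartbeats 800000 in
/-- Registered sub-goal form (stub `hole_chart_package2` of the crux item) of `hole_chart_package2'`.
[folklore] -/
theorem hole_chart_package2 : open Literature.Geometry.Lorentzian Filter Topology in ∀ (𝓢 : Spacetime 4) {N : ℕ} (i : Fin N) (M : Fin N → ℝ) (Λ : Fin N → ℝ → lorentzGroup) (ξ v : Fin N → ℝ → E3), (∀ j t, 0 < (((Λ j t : E4 ≃L[ℝ] E4) (E4.basisVector 0)) 0)) → (∀ j t, E4.spatial ((Λ j t : E4 ≃L[ℝ] E4) (E4.basisVector 0)) = (((Λ j t : E4 ≃L[ℝ] E4) (E4.basisVector 0)) 0) • v j t) → ∀ (U : Opens E4) (Φ : U → 𝓢.carrier),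 ContMDiff 𝓘(ℝ, E4) (𝓡 4) ((⊤ : ℕ∞) : WithTop ℕ∞) Φ → Tendsto (fun t ↦ 𝓢.deviationCk ⟨U, fun x ↦ Minkowski.bilin + ∑ j, (boostedKerrBilin (Λ j (x 0)) (E4.ofTimeSpace (x 0) (ξ j (x 0))) (M j) 0 x - Minkowski.bilin), fun x ↦ x 0, E4.spatialNorm⟩ Φ 2 t) atTop (𝓝 0) → ∀ {κ₀ : ℝ}, κ₀ < 1 → (∀ j t, ‖v j t‖ ≤ κ₀) → (∀ j, ContDiff ℝ ((⊤ : ℕ∞) : WithTop ℕ∞) (v j)) → (∀ j, ContDiff ℝ ((⊤ : ℕ∞) : WithTop ℕ∞) (ξ j)) → ∀ {Γ T₀ : ℝ}, (∀ j t, T₀ ≤ t → ∀ l, 1 ≤ l → l ≤ 2 → ‖iteratedDeriv l (v j) t‖ ≤ Γ) → (∀ j t, T₀ ≤ t → ∀ l, 1 ≤ l → l ≤ 2 → ‖iteratedDeriv l (ξ j) t‖ ≤ Γ) → (∀ j ≠ i, Tendsto (fun t ↦ ‖ξ i t - ξ j t‖) atTop atTop) → 0 < M i → ∀ {V : E3}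 (hV : ‖V‖ < 1), Tendsto (v i) atTop (𝓝 V) → Tendsto (deriv (ξ i)) atTop (𝓝 V) → (∀ l, 2 ≤ l → l ≤ 3 → Tendsto (fun t ↦ iteratedDeriv l (ξ i) t) atTop (𝓝 0)) → (∀ l, 1 ≤ l → l ≤ 3 → Tendsto (fun t ↦ iteratedDeriv l (v i) t) atTop (𝓝 0)) → ∀ {τ₀ : ℝ} {rin : Fin N → ℝ}, (∀ j, rin j < Kerr.rPlus (M j) 0) → {x : E4 | τ₀ < x 0 ∧ ∀ j, rin j < Kerr.radius 0 (poincareInv (Λ j (x 0)) (E4.ofTimeSpace (x 0) (ξ j (x 0))) x)} ⊆ (U : Set E4) → ∃ (T : ℝ) (ρ : ℝ → ℝ) (A : E4 → E4) (hAU : ∀ y ∈ boostedKerrExterior (Lorentz.boost V hV) 0 (M i) 0, A y ∈ U), τ₀ ≤ T ∧ ContDiff ℝ ((⊤ : ℕ∞) : WithTop ℕ∞) A ∧ Topology.IsOpenEmbedding A ∧ ContDiff ℝ ((⊤ : ℕ∞) : WithTop ℕ∞) ρ ∧ Tendsto ρ atTop atTop ∧ (∀ t, 0 < ρ t) ∧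 (∀ x : E4, T < A x 0 ∧ ‖E4.spatial (A x) - ξ i (A x 0)‖ < 2 * ρ (A x 0)) ∧ (∀ x : E4, Kerr.rPlus (M i) 0 < ‖E4.spatial ((Lorentz.boost V hV : E4 ≃L[ℝ] E4).symm x)‖ → ∀ j, Kerr.rPlus (M j) 0 < Kerr.radius 0 (poincareInv (Λ j (A x 0)) (E4.ofTimeSpace (A x 0) (ξ j (A x 0))) (A x))) ∧ (∀ x : E4, T + 1 ≤ x 0 → ‖E4.spatial ((Lorentz.boost V hV : E4 ≃L[ℝ] E4).symm x)‖ ≤ ρ (x 0) / 2 → A x = E4.ofTimeSpace (x 0) (ξ i (x 0) + (E4.spatial ((Lorentz.boost V hV : E4 ≃L[ℝ] E4).symm x) - (Lorentz.gamma (v i (x 0)) / (Lorentz.gamma (v i (x 0)) + 1) * inner ℝ (v i (x 0)) (E4.spatial ((Lorentz.boost V hV : E4 ≃L[ℝ] E4).symm x))) • v i (x 0)))) ∧ (∀ x : E4, T + 1 ≤ x 0 → ‖E4.spatial x - ξ i (x 0) + (Lorentz.gamma (v i (x 0)) ^ 2 / (Lorentz.gamma (v i (x 0)) + 1) * inner ℝ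 (v i (x 0)) (E4.spatial x - ξ i (x 0))) • v i (x 0)‖ ≤ ρ (x 0) / 2 → ∃ x' : E4, A x' = x ∧ x' 0 = x 0 ∧ E4.spatial ((Lorentz.boost V hV : E4 ≃L[ℝ] E4).symm x') = E4.spatial x - ξ i (x 0) + (Lorentz.gamma (v i (x 0)) ^ 2 / (Lorentz.gamma (v i (x 0)) + 1) * inner ℝ (v i (x 0)) (E4.spatial x - ξ i (x 0))) • v i (x 0) ∧ ((Lorentz.boost V hV : E4 ≃L[ℝ] E4).symm x') 0 = x 0 / Lorentz.gamma V - inner ℝ V (E4.spatial x - ξ i (x 0) + (Lorentz.gamma (v i (x 0)) ^ 2 / (Lorentz.gamma (v i (x 0)) + 1) * inner ℝ (v i (x 0)) (E4.spatial x - ξ i (x 0))) • v i (x 0))) ∧ (∀ (x : E4) (Λ' : lorentzGroup), 0 < ((Λ' : E4 ≃L[ℝ] E4) (E4.basisVector 0)) 0 → E4.spatial ((Λ' : E4 ≃L[ℝ] E4) (E4.basisVector 0)) = (((Λ' : E4 ≃L[ℝ] E4) (E4.basisVector 0)) 0) • v i (A x 0) → min ‖E4.spatial ((Lorentz.boost V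 hV : E4 ≃L[ℝ] E4).symm x)‖ (ρ (A x 0) / 2) ≤ E4.spatialNorm ((Λ' : E4 ≃L[ℝ] E4).symm (A x - E4.ofTimeSpace (A x 0) (ξ i (A x 0)))) ∧ E4.spatialNorm ((Λ' : E4 ≃L[ℝ] E4).symm (A x - E4.ofTimeSpace (A x 0) (ξ i (A x 0)))) ≤ ‖E4.spatial ((Lorentz.boost V hV : E4 ≃L[ℝ] E4).symm x)‖) ∧ (∃ θ : ℝ → ℝ, ContDiff ℝ ((⊤ : ℕ∞) : WithTop ℕ∞) θ ∧ StrictMono θ ∧ (∀ s, 0 < deriv θ s) ∧ (∀ s, T + 1 ≤ s → θ s = s) ∧ (∀ x : E4, A x 0 = θ (x 0)) ∧ ∀ x w : E4, (fderiv ℝ A x w) 0 = deriv θ (x 0) * w 0) ∧ ∀ (ψ : boostedKerrExterior (Lorentz.boost V hV) 0 (M i) 0 → 𝓢.carrier), (∀ y, ψ y = Φ ⟨A y.1, hAU y.1 y.2⟩) → ∀ R : ℝ, Tendsto (fun τ ↦ 𝓢.truncDeviationCk (boostedKerrBackground (Lorentz.boost V hV) 0 (M i) 0) ψ 2 R τ)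 atTop (𝓝 0) :=
  fun 𝓢 _ i M Λ ξ v hfut hvΛ U Φ hΦ hdev _ hκ₀ hvs hv hξ _ _ hvb hξb hsep hMi _ hV hvV hξV hξ0 hv0 _ _ hrin hU ↦
    hole_chart_package2' 𝓢 i M Λ ξ v hfut hvΛ U Φ hΦ hdev hκ₀ hvs hv hξ hvb hξb hsep hMi hV hvV hξV hξ0 hv0 hrin hU

end Package

end Summit.FinalStateConjecture.FinalStateConjecture.Theorems

end
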